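/-
Copyright (c) 2026 the pub-hodgecm-mathlib formalisation cell (harness21).  Prover seat hodgecm-mathlib-LH4-p02 (g0): road «S3-ram» (LEAD F0P3a-plan (g13); junction pen
F0P3a-p01 (g17), J-PACK v2-iso; S45 pen F0P3a-p02 (g17); HYP-PLAN v1 of F0P3a-p04 (g19), node (V2) «PER-VERTEX LINE COUNTS»); 2026-09-02.
-/
import Literature.NumberTheory.Automorphic.UnitaryLatticeTreeRootStarPredicateCountRamified          -- ★ G3⁗ p847467 (F0P2-p06): `ncard_neighborSet_pred_eq_natCard`; brings ★ `card_sub_one_mul_natCard_params_eq_ncard`, ★ `dotProduct_antidiagonal_three_mulVec`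
import Literature.NumberTheory.Rogawski1990.DepthZeroKappaTransferTypeOneRamifiedAxisVertexFrameCensus  -- ★ census p847662 (F0P3a-p02): `card_iso_vertexFrame_pred_eq_fin` ∕ `_interior_null` ∕ `_interior_class` ∕ `_end_null` ∕ `two_mul_…_end_class`
import Literature.NumberTheory.Automorphic.UnitaryLatticeTreeIsTreeDiagonalRamified                  -- ★ `ringChar_residueField_ne_two`
import HarnessLib

/-!
# The lattice graph of a hermitian space — PER-VERTEX LINE COUNTS at a region vertex of the isoceles configuration: from the residual SHAPE
# `Q_Ȳ(x̄) = c·(x̄₁ + t x̄₂)² + l·x̄₂²` on the cone `2x̄₀x̄₂ + x̄₁² = 0` to the numbers of children with null ∕ class line value (Kottwitz 1986 §3; Rogawski 1990 §4.9)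

Topic `NumberTheory/Automorphic`; namespace `Literature.NumberTheory.Automorphic.UnitaryLatticeTree`.  THEOREMS ONLY (no definition, no instance, no notation, no named fact,
no `sorry`); kernel lane `--supports stmt-HodgeConjecture-24833`.  Cell `pub/hodgecm-mathlib` (D-0151), crux H413; road «S3-ram» (Literature seeding, count-neutral); the
(a2) JUNCTION of the type-(1) ramified row, isoceles wave, S45 supplier `row_S45_hyperbolic` (S45 v4 bc98a4a1 :46) as the DAG of F0P3a-p04 (g19)'s HYP-PLAN v1
94da24021e513485: (V0) frame adaptation, (V1) SHAPE IN COORDINATES (p04), **(V2) PER-VERTEX LINE COUNTS = THIS FILE**, (V3) region directions + layers, (V4) token slices,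
(V5) assembly.

THE MATHEMATICS.  At a region vertex `v = u·L₀` the children are the `(uκ)·N₁` (`κ ∈ K₀`), and a child's LINE VALUE is the residue of the depth-`d` test
`(ϖ^d)⁻¹·B₀(κe₀, M·κe₀)` (`M = u⁻¹(γ−1)u`); the ★ bridge G3⁗ `ncard_neighborSet_pred_eq_natCard` counts the children whose value passes a square-class predicate `P` by
the normalised isotropic parameters `p` of the residual conic with `P(ᵗx̄_p (J̄₀Ȳ) x̄_p)`, `Ȳ = Y₀ mod ϖ`, `Y₀ = (ϖ^d)⁻¹M ∈ M₃(𝒪)`.  Node (V1) supplies the SHAPE of the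
residual form on the cone in the vertex frame: `ᵗx̄ (J̄₀Ȳ) x̄ = c·(x̄₁ + t x̄₂)² + l·x̄₂²` whenever `2x̄₀x̄₂ + x̄₁² = 0` (`c ≠ 0`; `l = 0` at ROOT∕INTERIOR vertices, `l ≠ 0` at END
vertices).  THIS FILE turns the shape into the line counts by ★ `card_sub_one_mul_natCard_params_eq_ncard` (`(q−1)·#params = #vectors`) and the ★ vertex-frame census
`card_iso_vertexFrame_*` (vector counts), cancelling `q − 1`:
* §1 (finite field `k`, `char k ≠ 2`, ANY matrix `Ȳ` with the shape): `ncard_iso_pred_eq_card_filter_of_shape` (the vector set of ★ G3⁗'s right side IS the census's filter),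
  **`natCard_params_pred_eq_of_shape`** (`#params(P) = [P 0] + #{s : P(l + c s²)}`), and the four values: `natCard_params_null_eq_two_of_shape` (`l = 0`: `2` null lines),
  `natCard_params_null_eq_of_shape_end` (`l ≠ 0`: `2 + χ(−lc)`, in `ℤ`), `natCard_params_quadraticChar_eq_of_shape` (`l = 0`: `(q−1)·[χ(c₀c) = σ]` lines of class `σ`),
  `two_mul_natCard_params_quadraticChar_eq_of_shape_end` (`l ≠ 0`: `2·# = q − 1 − χ(−lc) − σχ(c₀c)`).
* §2 (the lattice tree, tame-ramified tokens of ★ G3⁗): the same four numbers for the CHILDREN of `u·L₀` keyed by `κ ∈ K₀` with the residue test of ★ G3⁗ — NULL: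
  **`ncard_children_null_eq_two_of_shape`** ∕ **`ncard_children_null_eq_of_shape_end`**; CLASS: **`ncard_children_quadraticChar_eq_of_shape`** ∕
  **`two_mul_ncard_children_quadraticChar_eq_of_shape_end`** — binders = ★ G3⁗'s `(hσ hvσ hσϖ hϖ hres h2) (u) {d} (M) (Y₀) (hY₀)` + the shape `(c t l) (hc) (hshape)` on
  `Y₀.map residue`; `q = Nat.card 𝓀[K]`.
(V4) multiplies by `q` (★ keyed slice `UnitaryLatticeTreeSliceCountKeyedRamified`) and subtracts the region directions (V3); nothing here depends on (V1)'s proof, only on its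
conclusion SHAPE, taken as a hypothesis.
HONEST LABEL: HC_CM is proved only modulo the 2 remaining named inputs (hLiu418 24832, h413 24833) until rung 0 closes; finite-field ∕ residual bookkeeping over ★ results,
nothing printed is asserted; «S3-ram» has no books consequence.

## References
* [Kottwitz1986] R. E. Kottwitz, *Base change for unit elements of Hecke algebras*, Compositio Math. 60 (1986), §3 (counting fixed lattices by residual data).
* [Rogawski1990] J. D. Rogawski, *Automorphic Representations of Unitary Groups in Three Variables*, Ann. of Math. Stud. 123 (1990), §4.9 Prop. 4.9.1 (b) pp. 54–56.
* [BruhatTits1972] F. Bruhat, J. Tits, *Groupes réductifs sur un corps local I*, Publ. Math. IHÉS 41 (1972), §10 (the star of a vertex = the residual conic).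
* [IrelandRosen1990] K. Ireland, M. Rosen, *A Classical Introduction to Modern Number Theory*, 2nd ed. (1990), Ch. 8 §1–§2 (sums of the quadratic character).
-/

set_option autoImplicit false

noncomputable section

open scoped Valued WithZero Matrix MatrixGroups
open Finset

namespace Literature.NumberTheory.Automorphic.UnitaryLatticeTree

open Literature.NumberTheory.Automorphic Literature.NumberTheory.Automorphic.HermitianLattice
open Literature.GroupTheory.SpecificGroups Literature.NumberTheory.Rogawski1990

/-! ## §1 Finite-field half: from the SHAPE to the parameter counts -/

section FiniteField

variable {k : Type*} [Field k] [Fintype k] [DecidableEq k]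

/-- **The vector set of the ★ bridge is the census's filter, under the SHAPE**: `{x ≠ 0 : ᵗxJ̄₀x = 0 ∧ P(ᵗx(J̄₀Ȳ)x)}` has the cardinality of
`{x ≠ 0 : 2x₀x₂ + x₁² = 0 ∧ P(c(x₁ + t x₂)² + l x₂²)}` (`ᵗxJ̄₀x = 2x₀x₂ + x₁²` by ★ `dotProduct_antidiagonal_three_mulVec`; on the cone the shape rewrites the value).
[cite: Kottwitz1986, §3] [cite: BruhatTits1972, §10] -/
theorem ncard_iso_pred_eq_card_filter_of_shape (Y : Matrix (Fin 3) (Fin 3) k) (c t l : k)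
    (hshape : ∀ x : Fin 3 → k, 2 * x 0 * x 2 + x 1 ^ 2 = 0 → x ⬝ᵥ ((((StdForm.antidiagonal 3).over k) * Y) *ᵥ x) = c * (x 1 + t * x 2) ^ 2 + l * x 2 ^ 2)
    (P : k → Prop) [DecidablePred P] :
    {x : Fin 3 → k | x ≠ 0 ∧ x ⬝ᵥ (((StdForm.antidiagonal 3).over k) *ᵥ x) = 0 ∧ P (x ⬝ᵥ ((((StdForm.antidiagonal 3).over k) * Y) *ᵥ x))}.ncard =
      (univ.filter fun x : Fin 3 → k => x ≠ 0 ∧ 2 * x 0 * x 2 + x 1 ^ 2 = 0 ∧ P (c * (x 1 + t * x 2) ^ 2 + l * x 2 ^ 2)).card := by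
  rw [← Set.ncard_coe_finset]
  congr 1
  ext x
  simp only [Set.mem_setOf_eq, Finset.coe_filter, Finset.mem_univ, true_and]
  have hq : x ⬝ᵥ (((StdForm.antidiagonal 3).over k) *ᵥ x) = 2 * x 0 * x 2 + x 1 ^ 2 := by
    rw [dotProduct_antidiagonal_three_mulVec]; ring
  rw [hq]
  refine and_congr_right fun _ => ⟨fun ⟨hiso, hP⟩ => ⟨hiso, by rwa [← hshape x hiso]⟩, fun ⟨hiso, hP⟩ => ⟨hiso, by rwa [hshape x hiso]⟩⟩

/-- **THE LINE CENSUS FROM THE SHAPE** (normalised-parameter currency of ★ G3⁗): for `char k ≠ 2`, a matrix `Ȳ` whose isotropic values have the shape `c(x₁ + t x₂)² + l x₂²` on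
the cone, and a predicate `P` invariant under non-zero squares, `#{p : P(ᵗx̄_p(J̄₀Ȳ)x̄_p)} = [P 0] + #{s : P(l + c s²)}` (★ `(q−1)·#params = #vectors`, ★ vertex-frame census,
cancel `q − 1`). [cite: Kottwitz1986, §3] [cite: Rogawski1990, §4.9 Prop. 4.9.1 (b) p. 55] -/
theorem natCard_params_pred_eq_of_shape (hk : ringChar k ≠ 2) (Y : Matrix (Fin 3) (Fin 3) k) (c t l : k)
    (hshape : ∀ x : Fin 3 → k, 2 * x 0 * x 2 + x 1 ^ 2 = 0 → x ⬝ᵥ ((((StdForm.antidiagonal 3).over k) * Y) *ᵥ x) = c * (x 1 + t * x 2) ^ 2 + l * x 2 ^ 2)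
    (P : k → Prop) [DecidablePred P] (hP : ∀ a s : k, a ≠ 0 → (P (a * a * s) ↔ P s)) :
    Nat.card {p : Option {p : k × k // p.2 + (RingHom.id k) p.2 + p.1 * (RingHom.id k) p.1 = 0} //
        P ((p.elim (Pi.single 2 1) fun q => ![(1 : k), q.1.1, q.1.2]) ⬝ᵥ
          ((((StdForm.antidiagonal 3).over k) * Y) *ᵥ (p.elim (Pi.single 2 1) fun q => ![(1 : k), q.1.1, q.1.2])))} =
      (if P 0 then 1 else 0) + (univ.filter fun s : k => P (l + c * s ^ 2)).card := by
  have hmul := card_sub_one_mul_natCard_params_eq_ncard Y P hP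
  rw [ncard_iso_pred_eq_card_filter_of_shape Y c t l hshape P,
    card_iso_vertexFrame_pred_eq_fin hk c t l P (fun s z hz => by rw [pow_two]; exact hP z s hz), Nat.card_eq_fintype_card] at hmul
  have hq1 : 0 < Fintype.card k - 1 := by have := Fintype.one_lt_card (α := k); omega
  exact Nat.eq_of_mul_eq_mul_left hq1 hmul

/-- ROOT∕INTERIOR (`l = 0`, `c ≠ 0`): exactly **`2` NULL lines** (the two axial isotropic lines). [cite: Kottwitz1986, §3] [cite: Rogawski1990, §4.9 Prop. 4.9.1 (b) p. 55] -/
theorem natCard_params_null_eq_two_of_shape (hk : ringChar k ≠ 2) (Y : Matrix (Fin 3) (Fin 3) k) {c : k} (hc : c ≠ 0) (t : k) {l : k} (hl : l = 0)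
    (hshape : ∀ x : Fin 3 → k, 2 * x 0 * x 2 + x 1 ^ 2 = 0 → x ⬝ᵥ ((((StdForm.antidiagonal 3).over k) * Y) *ᵥ x) = c * (x 1 + t * x 2) ^ 2 + l * x 2 ^ 2) :
    Nat.card {p : Option {p : k × k // p.2 + (RingHom.id k) p.2 + p.1 * (RingHom.id k) p.1 = 0} //
        (p.elim (Pi.single 2 1) fun q => ![(1 : k), q.1.1, q.1.2]) ⬝ᵥ
          ((((StdForm.antidiagonal 3).over k) * Y) *ᵥ (p.elim (Pi.single 2 1) fun q => ![(1 : k), q.1.1, q.1.2])) = 0} = 2 := by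
  rw [natCard_params_pred_eq_of_shape hk Y c t l hshape (fun s => s = 0) (fun a s ha => by simp [ha]), hl]
  have h1 : (univ.filter fun s : k => (0 + c * s ^ 2 = 0)).card = 1 := by
    rw [Finset.card_eq_one]
    exact ⟨0, by ext s; simp [hc]⟩
  rw [h1]
  simp

/-- END (`l, c ≠ 0`): **`2 + χ(−lc)` NULL lines** (the inward line and `1 + χ(−lc)` outward null lines), in `ℤ`. [cite: Kottwitz1986, §3] [cite: Rogawski1990, §4.9 Prop. 4.9.1 (b) p. 55] -/
theorem natCard_params_null_eq_of_shape_end (hk : ringChar k ≠ 2) (Y : Matrix (Fin 3) (Fin 3) k) {c : k} (hc : c ≠ 0) (t : k) {l : k} (hl : l ≠ 0)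
    (hshape : ∀ x : Fin 3 → k, 2 * x 0 * x 2 + x 1 ^ 2 = 0 → x ⬝ᵥ ((((StdForm.antidiagonal 3).over k) * Y) *ᵥ x) = c * (x 1 + t * x 2) ^ 2 + l * x 2 ^ 2) :
    ((Nat.card {p : Option {p : k × k // p.2 + (RingHom.id k) p.2 + p.1 * (RingHom.id k) p.1 = 0} //
        (p.elim (Pi.single 2 1) fun q => ![(1 : k), q.1.1, q.1.2]) ⬝ᵥ
          ((((StdForm.antidiagonal 3).over k) * Y) *ᵥ (p.elim (Pi.single 2 1) fun q => ![(1 : k), q.1.1, q.1.2])) = 0} : ℕ) : ℤ) =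
      2 + quadraticChar k (-(l * c)) := by
  have hmul := card_sub_one_mul_natCard_params_eq_ncard Y (fun s => s = 0) (fun a s ha => by simp [ha])
  rw [ncard_iso_pred_eq_card_filter_of_shape Y c t l hshape (fun s => s = 0), Nat.card_eq_fintype_card] at hmul
  have hcen := card_iso_vertexFrame_end_null hk hc hl t
  have hq1 : ((Fintype.card k : ℤ) - 1) ≠ 0 := by have := Fintype.one_lt_card (α := k); omega
  have hmulZ := congrArg (fun n : ℕ => (n : ℤ)) hmul
  simp only [Nat.cast_mul, Nat.cast_sub (Nat.one_le_iff_ne_zero.2 Fintype.card_ne_zero), Nat.cast_one] at hmulZ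
  rw [hcen] at hmulZ
  exact mul_left_cancel₀ hq1 hmulZ

/-- ROOT∕INTERIOR (`l = 0`): the lines whose value has class `σ` for the key `c₀` number **`(q − 1)·[χ(c₀c) = σ]`** — all `q − 1` non-null lines lie in the ONE class of `c`.
[cite: Kottwitz1986, §3] [cite: Rogawski1990, §4.9 Prop. 4.9.1 (b) p. 55] [cite: IrelandRosen1990, Ch. 8 §1] -/
theorem natCard_params_quadraticChar_eq_of_shape (hk : ringChar k ≠ 2) (Y : Matrix (Fin 3) (Fin 3) k) {c : k} (t : k) {l : k} (hl : l = 0)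
    (hshape : ∀ x : Fin 3 → k, 2 * x 0 * x 2 + x 1 ^ 2 = 0 → x ⬝ᵥ ((((StdForm.antidiagonal 3).over k) * Y) *ᵥ x) = c * (x 1 + t * x 2) ^ 2 + l * x 2 ^ 2)
    (c₀ : k) {σ : ℤ} (hσ : σ = 1 ∨ σ = -1) :
    Nat.card {p : Option {p : k × k // p.2 + (RingHom.id k) p.2 + p.1 * (RingHom.id k) p.1 = 0} //
        quadraticChar k (c₀ * ((p.elim (Pi.single 2 1) fun q => ![(1 : k), q.1.1, q.1.2]) ⬝ᵥ
          ((((StdForm.antidiagonal 3).over k) * Y) *ᵥ (p.elim (Pi.single 2 1) fun q => ![(1 : k), q.1.1, q.1.2])))) = σ} =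
      (Fintype.card k - 1) * (if quadraticChar k (c₀ * c) = σ then 1 else 0) := by
  have hP : ∀ a s : k, a ≠ 0 → (quadraticChar k (c₀ * (a * a * s)) = σ ↔ quadraticChar k (c₀ * s) = σ) := fun a s ha => by
    rw [show c₀ * (a * a * s) = c₀ * s * a ^ 2 by ring, map_mul, map_pow, quadraticChar_sq_one ha, mul_one]
  have hmul := card_sub_one_mul_natCard_params_eq_ncard Y (fun s => quadraticChar k (c₀ * s) = σ) hP
  rw [ncard_iso_pred_eq_card_filter_of_shape Y c t l hshape (fun s => quadraticChar k (c₀ * s) = σ), hl,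
    card_iso_vertexFrame_interior_class hk t hσ (c := c) (c₀ := c₀), Nat.card_eq_fintype_card] at hmul
  have hq1 : 0 < Fintype.card k - 1 := by have := Fintype.one_lt_card (α := k); omega
  exact Nat.eq_of_mul_eq_mul_left hq1 hmul

/-- END (`l, c, c₀ ≠ 0`): **`2·#{lines of class σ} = q − 1 − χ(−lc) − σ·χ(c₀c)`**, in `ℤ`. [cite: Kottwitz1986, §3] [cite: Rogawski1990, §4.9 Prop. 4.9.1 (b) p. 55]
[cite: IrelandRosen1990, Ch. 8 §2] -/
theorem two_mul_natCard_params_quadraticChar_eq_of_shape_end (hk : ringChar k ≠ 2) (Y : Matrix (Fin 3) (Fin 3) k) {c : k} (hc : c ≠ 0) (t : k) {l : k} (hl : l ≠ 0)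
    (hshape : ∀ x : Fin 3 → k, 2 * x 0 * x 2 + x 1 ^ 2 = 0 → x ⬝ᵥ ((((StdForm.antidiagonal 3).over k) * Y) *ᵥ x) = c * (x 1 + t * x 2) ^ 2 + l * x 2 ^ 2)
    {c₀ : k} (hc₀ : c₀ ≠ 0) {σ : ℤ} (hσ : σ = 1 ∨ σ = -1) :
    2 * ((Nat.card {p : Option {p : k × k // p.2 + (RingHom.id k) p.2 + p.1 * (RingHom.id k) p.1 = 0} //
        quadraticChar k (c₀ * ((p.elim (Pi.single 2 1) fun q => ![(1 : k), q.1.1, q.1.2]) ⬝ᵥ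
          ((((StdForm.antidiagonal 3).over k) * Y) *ᵥ (p.elim (Pi.single 2 1) fun q => ![(1 : k), q.1.1, q.1.2])))) = σ} : ℕ) : ℤ) =
      (Fintype.card k : ℤ) - 1 - quadraticChar k (-(l * c)) - σ * quadraticChar k (c₀ * c) := by
  have hP : ∀ a s : k, a ≠ 0 → (quadraticChar k (c₀ * (a * a * s)) = σ ↔ quadraticChar k (c₀ * s) = σ) := fun a s ha => by
    rw [show c₀ * (a * a * s) = c₀ * s * a ^ 2 by ring, map_mul, map_pow, quadraticChar_sq_one ha, mul_one]
  have hmul := card_sub_one_mul_natCard_params_eq_ncard Y (fun s => quadraticChar k (c₀ * s) = σ) hP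
  rw [ncard_iso_pred_eq_card_filter_of_shape Y c t l hshape (fun s => quadraticChar k (c₀ * s) = σ), Nat.card_eq_fintype_card] at hmul
  have hcen := two_mul_card_iso_vertexFrame_end_class hk hc hl hc₀ t hσ
  have hq1 : ((Fintype.card k : ℤ) - 1) ≠ 0 := by have := Fintype.one_lt_card (α := k); omega
  have hmulZ := congrArg (fun n : ℕ => (2 : ℤ) * (n : ℤ)) hmul
  simp only [Nat.cast_mul, Nat.cast_sub (Nat.one_le_iff_ne_zero.2 Fintype.card_ne_zero), Nat.cast_one] at hmulZ
  rw [hcen, mul_left_comm] at hmulZ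
  exact mul_left_cancel₀ hq1 hmulZ

end FiniteField

/-! ## §2 Lattice half: the children of `u·L₀` passing the null ∕ class test (★ G3⁗ bridge) -/

section Lattice

variable {K : Type*} [Field K] [Valued K ℤᵐ⁰] {σ : K →+* K} {ϖ : K}

/-- **ROOT∕INTERIOR VERTEX: exactly `2` children with NULL line value.**  ★ G3⁗'s binders (`M` the consumer's `u⁻¹(γ−1)u`, `Y₀ = (ϖ^d)⁻¹M` integral) + the SHAPE on
`Ȳ = Y₀ mod ϖ` with `l = 0`, `c ≠ 0`. [cite: Kottwitz1986, §3] [cite: Rogawski1990, §4.9 Prop. 4.9.1 (b) p. 55] [cite: BruhatTits1972, §10] -/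
theorem ncard_children_null_eq_two_of_shape (hσ : ∀ x, σ (σ x) = x) (hvσ : ∀ a, Valued.v (σ a) = Valued.v a) (hσϖ : σ ϖ = -ϖ)
    (hϖ : Valued.v ϖ = WithZero.exp (-1 : ℤ)) (hres : ∀ x : K, Valued.v x ≤ 1 → Valued.v (σ x - x) < 1) (h2 : Valued.v (2 : K) = 1) [Finite 𝓀[K]]
    (u : unitaryGroupOfForm σ ((StdForm.antidiagonal 3).over K))
    {d : ℕ} (M : Matrix (Fin 3) (Fin 3) K) (Y₀ : Matrix (Fin 3) (Fin 3) 𝒪[K]) (hY₀ : ∀ i j, ((Y₀ i j : 𝒪[K]) : K) = (ϖ ^ d)⁻¹ * M i j)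
    {c : 𝓀[K]} (hc : c ≠ 0) (t : 𝓀[K]) {l : 𝓀[K]} (hl : l = 0)
    (hshape : ∀ x : Fin 3 → 𝓀[K], 2 * x 0 * x 2 + x 1 ^ 2 = 0 →
      x ⬝ᵥ ((((StdForm.antidiagonal 3).over 𝓀[K]) * Y₀.map (IsLocalRing.residue 𝒪[K])) *ᵥ x) = c * (x 1 + t * x 2) ^ 2 + l * x 2 ^ 2) :
    {w | w ∈ (latticeGraph σ ϖ ((StdForm.antidiagonal 3).over K)).neighborSet
          (latticeGraphIso σ ϖ ((StdForm.antidiagonal 3).over K) u ⟨stdLattice K 3, 0, isSelfDualLattice_stdLattice_three_of_v hϖ⟩) ∧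
        ∃ κ : unitaryGroupOfForm σ ((StdForm.antidiagonal 3).over K), κ ∈ unitaryInt σ ((StdForm.antidiagonal 3).over K) ∧
          w.1 = mapGL (((u * κ : unitaryGroupOfForm σ ((StdForm.antidiagonal 3).over K)) : GL (Fin 3) K)) (latt (Matrix.diagonal ![(1 : K), 1, ϖ])) ∧
          ∃ t₀ : 𝒪[K], (t₀ : K) = (ϖ ^ d)⁻¹ * B₀ σ 3 (((κ : GL (Fin 3) K) : Matrix (Fin 3) (Fin 3) K) *ᵥ (Pi.single 0 1))
              (M *ᵥ (((κ : GL (Fin 3) K) : Matrix (Fin 3) (Fin 3) K) *ᵥ (Pi.single 0 1))) ∧ IsLocalRing.residue 𝒪[K] t₀ = 0}.ncard = 2 := by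
  classical
  haveI : Fintype 𝓀[K] := Fintype.ofFinite _
  rw [ncard_neighborSet_pred_eq_natCard hσ hvσ hσϖ hϖ hres h2 u M Y₀ hY₀ (fun s => s = 0) (fun a s ha => by simp [ha])]
  exact natCard_params_null_eq_two_of_shape (ringChar_residueField_ne_two h2) _ hc t hl hshape

/-- **END VERTEX: `2 + χ(−lc)` children with NULL line value** (in `ℤ`; `l, c ≠ 0`). [cite: Kottwitz1986, §3] [cite: Rogawski1990, §4.9 Prop. 4.9.1 (b) p. 55] [cite: BruhatTits1972, §10] -/
theorem ncard_children_null_eq_of_shape_end (hσ : ∀ x, σ (σ x) = x) (hvσ : ∀ a, Valued.v (σ a) = Valued.v a) (hσϖ : σ ϖ = -ϖ)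
    (hϖ : Valued.v ϖ = WithZero.exp (-1 : ℤ)) (hres : ∀ x : K, Valued.v x ≤ 1 → Valued.v (σ x - x) < 1) (h2 : Valued.v (2 : K) = 1) [Fintype 𝓀[K]] [DecidableEq 𝓀[K]]
    (u : unitaryGroupOfForm σ ((StdForm.antidiagonal 3).over K))
    {d : ℕ} (M : Matrix (Fin 3) (Fin 3) K) (Y₀ : Matrix (Fin 3) (Fin 3) 𝒪[K]) (hY₀ : ∀ i j, ((Y₀ i j : 𝒪[K]) : K) = (ϖ ^ d)⁻¹ * M i j)
    {c : 𝓀[K]} (hc : c ≠ 0) (t : 𝓀[K]) {l : 𝓀[K]} (hl : l ≠ 0)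
    (hshape : ∀ x : Fin 3 → 𝓀[K], 2 * x 0 * x 2 + x 1 ^ 2 = 0 →
      x ⬝ᵥ ((((StdForm.antidiagonal 3).over 𝓀[K]) * Y₀.map (IsLocalRing.residue 𝒪[K])) *ᵥ x) = c * (x 1 + t * x 2) ^ 2 + l * x 2 ^ 2) :
    (({w | w ∈ (latticeGraph σ ϖ ((StdForm.antidiagonal 3).over K)).neighborSet
          (latticeGraphIso σ ϖ ((StdForm.antidiagonal 3).over K) u ⟨stdLattice K 3, 0, isSelfDualLattice_stdLattice_three_of_v hϖ⟩) ∧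
        ∃ κ : unitaryGroupOfForm σ ((StdForm.antidiagonal 3).over K), κ ∈ unitaryInt σ ((StdForm.antidiagonal 3).over K) ∧
          w.1 = mapGL (((u * κ : unitaryGroupOfForm σ ((StdForm.antidiagonal 3).over K)) : GL (Fin 3) K)) (latt (Matrix.diagonal ![(1 : K), 1, ϖ])) ∧
          ∃ t₀ : 𝒪[K], (t₀ : K) = (ϖ ^ d)⁻¹ * B₀ σ 3 (((κ : GL (Fin 3) K) : Matrix (Fin 3) (Fin 3) K) *ᵥ (Pi.single 0 1))
              (M *ᵥ (((κ : GL (Fin 3) K) : Matrix (Fin 3) (Fin 3) K) *ᵥ (Pi.single 0 1))) ∧ IsLocalRing.residue 𝒪[K] t₀ = 0}.ncard : ℕ) : ℤ) =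
      2 + quadraticChar 𝓀[K] (-(l * c)) := by
  rw [ncard_neighborSet_pred_eq_natCard hσ hvσ hσϖ hϖ hres h2 u M Y₀ hY₀ (fun s => s = 0) (fun a s ha => by simp [ha])]
  exact natCard_params_null_eq_of_shape_end (ringChar_residueField_ne_two h2) _ hc t hl hshape

/-- **ROOT∕INTERIOR VERTEX: `(q − 1)·[χ(c₀c) = σ]` children whose line value has class `σ` for the key `c₀`** (`l = 0`; the `q − 1` non-null lines lie in ONE class).
[cite: Kottwitz1986, §3] [cite: Rogawski1990, §4.9 Prop. 4.9.1 (b) p. 55] [cite: IrelandRosen1990, Ch. 8 §1] -/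
theorem ncard_children_quadraticChar_eq_of_shape (hσ : ∀ x, σ (σ x) = x) (hvσ : ∀ a, Valued.v (σ a) = Valued.v a) (hσϖ : σ ϖ = -ϖ)
    (hϖ : Valued.v ϖ = WithZero.exp (-1 : ℤ)) (hres : ∀ x : K, Valued.v x ≤ 1 → Valued.v (σ x - x) < 1) (h2 : Valued.v (2 : K) = 1) [Fintype 𝓀[K]] [DecidableEq 𝓀[K]]
    (u : unitaryGroupOfForm σ ((StdForm.antidiagonal 3).over K))
    {d : ℕ} (M : Matrix (Fin 3) (Fin 3) K) (Y₀ : Matrix (Fin 3) (Fin 3) 𝒪[K]) (hY₀ : ∀ i j, ((Y₀ i j : 𝒪[K]) : K) = (ϖ ^ d)⁻¹ * M i j)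
    {c : 𝓀[K]} (t : 𝓀[K]) {l : 𝓀[K]} (hl : l = 0)
    (hshape : ∀ x : Fin 3 → 𝓀[K], 2 * x 0 * x 2 + x 1 ^ 2 = 0 →
      x ⬝ᵥ ((((StdForm.antidiagonal 3).over 𝓀[K]) * Y₀.map (IsLocalRing.residue 𝒪[K])) *ᵥ x) = c * (x 1 + t * x 2) ^ 2 + l * x 2 ^ 2)
    (c₀ : 𝓀[K]) {τ : ℤ} (hτ : τ = 1 ∨ τ = -1) :
    {w | w ∈ (latticeGraph σ ϖ ((StdForm.antidiagonal 3).over K)).neighborSet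
          (latticeGraphIso σ ϖ ((StdForm.antidiagonal 3).over K) u ⟨stdLattice K 3, 0, isSelfDualLattice_stdLattice_three_of_v hϖ⟩) ∧
        ∃ κ : unitaryGroupOfForm σ ((StdForm.antidiagonal 3).over K), κ ∈ unitaryInt σ ((StdForm.antidiagonal 3).over K) ∧
          w.1 = mapGL (((u * κ : unitaryGroupOfForm σ ((StdForm.antidiagonal 3).over K)) : GL (Fin 3) K)) (latt (Matrix.diagonal ![(1 : K), 1, ϖ])) ∧
          ∃ t₀ : 𝒪[K], (t₀ : K) = (ϖ ^ d)⁻¹ * B₀ σ 3 (((κ : GL (Fin 3) K) : Matrix (Fin 3) (Fin 3) K) *ᵥ (Pi.single 0 1))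
              (M *ᵥ (((κ : GL (Fin 3) K) : Matrix (Fin 3) (Fin 3) K) *ᵥ (Pi.single 0 1))) ∧ quadraticChar 𝓀[K] (c₀ * IsLocalRing.residue 𝒪[K] t₀) = τ}.ncard =
      (Fintype.card 𝓀[K] - 1) * (if quadraticChar 𝓀[K] (c₀ * c) = τ then 1 else 0) := by
  have hP : ∀ a s : 𝓀[K], a ≠ 0 → (quadraticChar 𝓀[K] (c₀ * (a * a * s)) = τ ↔ quadraticChar 𝓀[K] (c₀ * s) = τ) := fun a s ha => by
    rw [show c₀ * (a * a * s) = c₀ * s * a ^ 2 by ring, map_mul, map_pow, quadraticChar_sq_one ha, mul_one]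
  rw [ncard_neighborSet_pred_eq_natCard hσ hvσ hσϖ hϖ hres h2 u M Y₀ hY₀ (fun s => quadraticChar 𝓀[K] (c₀ * s) = τ) hP]
  exact natCard_params_quadraticChar_eq_of_shape (ringChar_residueField_ne_two h2) _ t hl hshape c₀ hτ

/-- **END VERTEX: `2·#{children of class σ} = q − 1 − χ(−lc) − σ·χ(c₀c)`** (in `ℤ`; `l, c, c₀ ≠ 0`). [cite: Kottwitz1986, §3] [cite: Rogawski1990, §4.9 Prop. 4.9.1 (b) p. 55]
[cite: IrelandRosen1990, Ch. 8 §2] -/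
theorem two_mul_ncard_children_quadraticChar_eq_of_shape_end (hσ : ∀ x, σ (σ x) = x) (hvσ : ∀ a, Valued.v (σ a) = Valued.v a) (hσϖ : σ ϖ = -ϖ)
    (hϖ : Valued.v ϖ = WithZero.exp (-1 : ℤ)) (hres : ∀ x : K, Valued.v x ≤ 1 → Valued.v (σ x - x) < 1) (h2 : Valued.v (2 : K) = 1) [Fintype 𝓀[K]] [DecidableEq 𝓀[K]]
    (u : unitaryGroupOfForm σ ((StdForm.antidiagonal 3).over K))
    {d : ℕ} (M : Matrix (Fin 3) (Fin 3) K) (Y₀ : Matrix (Fin 3) (Fin 3) 𝒪[K]) (hY₀ : ∀ i j, ((Y₀ i j : 𝒪[K]) : K) = (ϖ ^ d)⁻¹ * M i j)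
    {c : 𝓀[K]} (hc : c ≠ 0) (t : 𝓀[K]) {l : 𝓀[K]} (hl : l ≠ 0)
    (hshape : ∀ x : Fin 3 → 𝓀[K], 2 * x 0 * x 2 + x 1 ^ 2 = 0 →
      x ⬝ᵥ ((((StdForm.antidiagonal 3).over 𝓀[K]) * Y₀.map (IsLocalRing.residue 𝒪[K])) *ᵥ x) = c * (x 1 + t * x 2) ^ 2 + l * x 2 ^ 2)
    {c₀ : 𝓀[K]} (hc₀ : c₀ ≠ 0) {τ : ℤ} (hτ : τ = 1 ∨ τ = -1) :
    2 * (({w | w ∈ (latticeGraph σ ϖ ((StdForm.antidiagonal 3).over K)).neighborSet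
          (latticeGraphIso σ ϖ ((StdForm.antidiagonal 3).over K) u ⟨stdLattice K 3, 0, isSelfDualLattice_stdLattice_three_of_v hϖ⟩) ∧
        ∃ κ : unitaryGroupOfForm σ ((StdForm.antidiagonal 3).over K), κ ∈ unitaryInt σ ((StdForm.antidiagonal 3).over K) ∧
          w.1 = mapGL (((u * κ : unitaryGroupOfForm σ ((StdForm.antidiagonal 3).over K)) : GL (Fin 3) K)) (latt (Matrix.diagonal ![(1 : K), 1, ϖ])) ∧
          ∃ t₀ : 𝒪[K], (t₀ : K) = (ϖ ^ d)⁻¹ * B₀ σ 3 (((κ : GL (Fin 3) K) : Matrix (Fin 3) (Fin 3) K) *ᵥ (Pi.single 0 1))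
              (M *ᵥ (((κ : GL (Fin 3) K) : Matrix (Fin 3) (Fin 3) K) *ᵥ (Pi.single 0 1))) ∧ quadraticChar 𝓀[K] (c₀ * IsLocalRing.residue 𝒪[K] t₀) = τ}.ncard : ℕ) : ℤ) =
      (Fintype.card 𝓀[K] : ℤ) - 1 - quadraticChar 𝓀[K] (-(l * c)) - τ * quadraticChar 𝓀[K] (c₀ * c) := by
  have hP : ∀ a s : 𝓀[K], a ≠ 0 → (quadraticChar 𝓀[K] (c₀ * (a * a * s)) = τ ↔ quadraticChar 𝓀[K] (c₀ * s) = τ) := fun a s ha => by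
    rw [show c₀ * (a * a * s) = c₀ * s * a ^ 2 by ring, map_mul, map_pow, quadraticChar_sq_one ha, mul_one]
  rw [ncard_neighborSet_pred_eq_natCard hσ hvσ hσϖ hϖ hres h2 u M Y₀ hY₀ (fun s => quadraticChar 𝓀[K] (c₀ * s) = τ) hP]
  exact two_mul_natCard_params_quadraticChar_eq_of_shape_end (ringChar_residueField_ne_two h2) _ hc t hl hshape hc₀ hτ

end Lattice

end Literature.NumberTheory.Automorphic.UnitaryLatticeTree

end
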